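import Summits.AtomisticToContinuum.HydrodynamicLimit.Theorems.CollisionIsometryCLTAdaptedWeightCLTBHEntropyBudgetDerivBound

/-!
# Entropy budget (stub `stub_entropyBudget`, line `block-h-dissipation-closure`, crux `AdaptedWeightCLT`,
stmt-AtomisticToContinuum-14868; `--supports`) — helper 7: an integrable dominator of the transported
entropy density, uniform in the weights

With the kernel bounds `0 ≤ ψ_N ≤ A`, `‖∇ψ_N‖ ≤ L`, a velocity bound `V` and a cell-mass floor `S₀ > 0`
fixed, the master pointwise bound of helper 6 is turned into
`|(1 + log f̂_{w'}(v)) · cW(w')⁻¹ dF_{w'}(v)| ≤ K (1 + |v|)⁴ (Σ_i G_h(v − v_i) + M_{2Θ,0}(v))`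
for EVERY configuration `w'` with the velocities of `w` and `cW(w', x) ≥ S₀` (`Θ = h² + (2V)²/3`; the KDE is
compared with `A cW⁻¹ Σ_i G_h(· − v_i)`, the floor with the Gaussian envelope of helper 1). The right side is
Lebesgue integrable and does not depend on the weights: it dominates the `r`-derivative of `f̂ log f̂` along
a free flight locally uniformly in `r`, which is what differentiation under the integral sign needs
(helper 8).
-/

namespace Summit.AtomisticToContinuum.HydrodynamicLimit.Theorems.BlockHDissipation

open scoped BigOperators Topology Classical MeasureTheory ENNReal InnerProductSpace
open Filter Set MeasureTheory
open Literature.Analysis.FluidPDE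
open Literature.Analysis.FunctionSpaces (Torus.IsSmooth)
open Summit.AtomisticToContinuum.HydrodynamicLimit.Theorems.ContactSourceDuhamel (T3 V3 Cfg Vel Flow Flows)
open Literature.MathematicalPhysics.KineticTheory (localMaxwellian_pos localMaxwellian_nonneg continuous_localMaxwellian)

noncomputable section

namespace EntropyBudget

variable {N : ℕ} {ψ : ℕ → T3 → ℝ} {h δ : ℝ} (w : Cfg N) (x : T3)

/-! ## Weight-free majorants of the pieces -/

/-- `B₁ ≤ (N+1) L V`. -/
theorem B1_le {L V : ℝ} (hL : ∀ y, ‖Literature.Analysis.FunctionSpaces.Torus.gradient (ψ N) y‖ ≤ L)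
    (hV : ∀ i, ‖(w i).2‖ ≤ V) : (∑ i, |Literature.Analysis.FunctionSpaces.Torus.fderiv (ψ N) ((w i).1 - x) (w i).2|) ≤ ((N + 1 : ℕ) : ℝ) * L * V := by
  have hL0 := L_nonneg hL
  calc (∑ i, |Literature.Analysis.FunctionSpaces.Torus.fderiv (ψ N) ((w i).1 - x) (w i).2|) ≤ ∑ _i : Fin (N + 1), L *
      V := Finset.sum_le_sum fun i _ =>
        (abs_torusFderiv_le hL _ _).trans (mul_le_mul_of_nonneg_left (hV i) hL0)
    _ = ((N + 1 : ℕ) : ℝ) * L * V := by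
        rw [Finset.sum_const, Finset.card_univ, Fintype.card_fin, nsmul_eq_mul]; ring

/-- `Σ_i |β_i| G_h(v − v_i) ≤ L V Σ_i G_h(v − v_i)`. -/
theorem sum_abs_dcw_gauss_le (hh : 0 < h) {L V : ℝ}
    (hL : ∀ y, ‖Literature.Analysis.FunctionSpaces.Torus.gradient (ψ N) y‖ ≤ L) (hV : ∀ i, ‖(w i).2‖ ≤ V) (v : V3) :
    ∑ i, |Literature.Analysis.FunctionSpaces.Torus.fderiv (ψ N) ((w i).1 - x) (w i).2| * gauss h (w i).2 v ≤
      L * V * ∑ i, gauss h (w i).2 v := by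
  have hL0 := L_nonneg hL
  rw [Finset.mul_sum]
  exact Finset.sum_le_sum fun i _ => mul_le_mul_of_nonneg_right
    ((abs_torusFderiv_le hL _ _).trans (mul_le_mul_of_nonneg_left (hV i) hL0)) (gauss_pos hh _ _).le

/-- KDE AGAINST THE GAUSSIAN PROFILE: `f̃(v) ≤ S₀⁻¹ A Σ_i G_h(v − v_i)` for weights `≤ A` and `cW ≥ S₀ > 0`. -/
theorem kde_le_sum_gauss (hψ : ∀ y, 0 ≤ ψ N y) (hh : 0 < h) {A S₀ : ℝ} (hA : ∀ y, ψ N y ≤ A) (hS₀ : 0 < S₀)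
    (hS : S₀ ≤ cW N ψ w x) (v : V3) : kde N ψ h w x v ≤ S₀⁻¹ * A * ∑ i, gauss h (w i).2 v := by
  have hA0 : 0 ≤ A := (hψ 0).trans (hA 0)
  unfold kde
  have h1 : ∑ i, cw N ψ w x i * gauss h (w i).2 v ≤ A * ∑ i, gauss h (w i).2 v := by
    rw [Finset.mul_sum]
    exact Finset.sum_le_sum fun i _ => mul_le_mul_of_nonneg_right (hA _) (gauss_pos hh _ _).le
  have h2 : 0 ≤ ∑ i, cw N ψ w x i * gauss h (w i).2 v :=
    Finset.sum_nonneg fun i _ => mul_nonneg (cw_nonneg w x hψ i) (gauss_pos hh _ _).le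
  calc (cW N ψ w x)⁻¹ * ∑ i, cw N ψ w x i * gauss h (w i).2 v ≤ S₀⁻¹ * (A * ∑ i, gauss h (w i).2 v) :=
        mul_le_mul (inv_anti₀ hS₀ hS) h1 h2 (by positivity)
    _ = _ := by ring

/-- `|v − ū|² ≤ 2 (1 + V²) (1 + |v|)²`. -/
theorem norm_sub_cU_sq_le (hψ : ∀ y, 0 ≤ ψ N y) {V : ℝ} (hV : ∀ i, ‖(w i).2‖ ≤ V) (v : V3) :
    ‖v - cU N ψ w x‖ ^ 2 ≤ 2 * (1 + V ^ 2) * (1 + ‖v‖) ^ 2 := by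
  have hnv := norm_nonneg v
  have h1 : ‖v - cU N ψ w x‖ ≤ ‖v‖ + V := (norm_sub_le _ _).trans (add_le_add le_rfl (norm_cU_le w x hψ hV))
  have h2 : ‖v - cU N ψ w x‖ ^ 2 ≤ (‖v‖ + V) ^ 2 := pow_le_pow_left₀ (norm_nonneg _) h1 2
  have h3 : (‖v‖ + V) ^ 2 ≤ 2 * ‖v‖ ^ 2 + 2 * V ^ 2 := by nlinarith only [sq_nonneg (‖v‖ - V)]
  have h5 : ‖v‖ ^ 2 ≤ (1 + ‖v‖) ^ 2 := by nlinarith only [hnv]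
  have h6 : (1 : ℝ) ≤ (1 + ‖v‖) ^ 2 := by nlinarith only [hnv]
  have h7 := mul_le_mul_of_nonneg_left h6 (sq_nonneg V)
  have e : 2 * (1 + V ^ 2) * (1 + ‖v‖) ^ 2 = 2 * (1 + ‖v‖) ^ 2 + 2 * (V ^ 2 * (1 + ‖v‖) ^ 2) := by ring
  rw [e]
  linarith only [h2, h3, h5, h7]

/-- THE FLOOR'S POLYNOMIAL FACTOR: `(8/3)V²(q/(2h⁴) + 3/(2h²)) + 2V√q/h² ≤ k₂ (1 + |v|)²`, `q = |v − ū|²`,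
`k₂ = (4V² + V)/h² + 2 (4V²/(3h⁴) + V/h²)(1 + V²)`. -/
theorem floorPoly_le (hψ : ∀ y, 0 ≤ ψ N y) (hh : 0 < h) {V : ℝ} (hV : ∀ i, ‖(w i).2‖ ≤ V) (v : V3) :
    8 / 3 * V ^ 2 * (‖v - cU N ψ w x‖ ^ 2 / (2 * h ^ 4) + 3 / (2 * h ^ 2)) + 2 * V * ‖v - cU N ψ w x‖ / h ^ 2 ≤
      ((4 * V ^ 2 + V) / h ^ 2 + 2 * (4 * V ^ 2 / (3 * h ^ 4) + V / h ^ 2) * (1 + V ^ 2)) * (1 + ‖v‖) ^ 2 := by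
  have hV0 := V_nonneg w hV
  have hq := norm_sub_cU_sq_le w x hψ hV v
  have hq0 : 0 ≤ ‖v - cU N ψ w x‖ := norm_nonneg _
  have ht1 : (1 : ℝ) ≤ (1 + ‖v‖) ^ 2 := by nlinarith only [norm_nonneg v]
  have h1 : 2 * V * ‖v - cU N ψ w x‖ ≤ V * (1 + ‖v - cU N ψ w x‖ ^ 2) := by
    nlinarith only [sq_nonneg (‖v - cU N ψ w x‖ - 1), hV0]
  have h2 : 8 / 3 * V ^ 2 * (‖v - cU N ψ w x‖ ^ 2 / (2 * h ^ 4) + 3 / (2 * h ^ 2)) + 2 * V * ‖v - cU N ψ w x‖ / h ^ 2 ≤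
      (4 * V ^ 2 + V) / h ^ 2 + (4 * V ^ 2 / (3 * h ^ 4) + V / h ^ 2) * ‖v - cU N ψ w x‖ ^ 2 := by
    have h3 : 2 * V * ‖v - cU N ψ w x‖ / h ^ 2 ≤ V * (1 + ‖v - cU N ψ w x‖ ^ 2) / h ^ 2 :=
      div_le_div_of_nonneg_right h1 (by positivity)
    have e : 8 / 3 * V ^ 2 * (‖v - cU N ψ w x‖ ^ 2 / (2 * h ^ 4) + 3 / (2 * h ^ 2)) + V * (1 + ‖v - cU N ψ w x‖ ^ 2) / h ^ 2 =
        (4 * V ^ 2 + V) / h ^ 2 + (4 * V ^ 2 / (3 * h ^ 4) + V / h ^ 2) * ‖v - cU N ψ w x‖ ^ 2 := by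
      field_simp; ring
    linarith only [h3, e]
  have ha₀ : 0 ≤ (4 * V ^ 2 + V) / h ^ 2 := by positivity
  have ha₁ : 0 ≤ 4 * V ^ 2 / (3 * h ^ 4) + V / h ^ 2 := by positivity
  have h4 : (4 * V ^ 2 + V) / h ^ 2 ≤ (4 * V ^ 2 + V) / h ^ 2 * (1 + ‖v‖) ^ 2 := le_mul_of_one_le_right ha₀ ht1
  have h5 := mul_le_mul_of_nonneg_left hq ha₁
  nlinarith only [h2, h4, h5]

/-- THE LOGARITHMIC FACTOR: `c₀ + q/(2h²) ≤ k₁ (1 + |v|)²`, with `c₀ ≤ cm` (temperature window) and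
`k₁ = cm + (1 + V²)/h²`. -/
theorem logFactor_le (hψ : ∀ y, 0 ≤ ψ N y) (hh : 0 < h) {V : ℝ} (hV : ∀ i, ‖(w i).2‖ ≤ V) (v : V3) :
    (1 + |Real.log ((2 * Real.pi * h ^ 2) ^ (-(3 : ℝ) / 2))| + |Real.log δ| +
        3 / 2 * |Real.log (2 * Real.pi * (cT N ψ w x + h ^ 2))|) + ‖v - cU N ψ w x‖ ^ 2 / (2 * h ^ 2) ≤
      ((1 + |Real.log ((2 * Real.pi * h ^ 2) ^ (-(3 : ℝ) / 2))| + |Real.log δ| +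
        3 / 2 * (|Real.log (2 * Real.pi * h ^ 2)| + |Real.log (2 * Real.pi * (h ^ 2 + (2 * V) ^ 2 / 3))|)) +
          (1 + V ^ 2) / h ^ 2) * (1 + ‖v‖) ^ 2 := by
  have hq := norm_sub_cU_sq_le w x hψ hV v
  have hlog := abs_log_between hh (h2_le_theta w x hψ) (theta_le (h := h) w x hψ hV)
  have ht1 : (1 : ℝ) ≤ (1 + ‖v‖) ^ 2 := by nlinarith only [norm_nonneg v]
  have hcm0 : 0 ≤ 1 + |Real.log ((2 * Real.pi * h ^ 2) ^ (-(3 : ℝ) / 2))| + |Real.log δ| +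
      3 / 2 * (|Real.log (2 * Real.pi * h ^ 2)| + |Real.log (2 * Real.pi * (h ^ 2 + (2 * V) ^ 2 / 3))|) := by positivity
  have h1 : ‖v - cU N ψ w x‖ ^ 2 / (2 * h ^ 2) ≤ (1 + V ^ 2) / h ^ 2 * (1 + ‖v‖) ^ 2 := by
    rw [div_le_iff₀ (by positivity)]
    calc ‖v - cU N ψ w x‖ ^ 2 ≤ 2 * (1 + V ^ 2) * (1 + ‖v‖) ^ 2 := hq
      _ = (1 + V ^ 2) / h ^ 2 * (1 + ‖v‖) ^ 2 * (2 * h ^ 2) := by field_simp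
  have h2 := le_mul_of_one_le_right hcm0 ht1
  nlinarith only [h1, h2, hlog]

/-! ## The dominator -/

/-- `(1 + |v|)⁴ (Σ_i G_h(v − v_i) + M_{2Θ,0}(v))` is Lebesgue integrable. -/
theorem integrable_profile (hh : 0 < h) {Θ : ℝ} (hΘ : 0 < Θ) :
    Integrable fun v : V3 => (1 + ‖v‖) ^ 4 * (∑ i, gauss h (w i).2 v + localMaxwellian 1 (2 * Θ) 0 v) := by
  have h1 : ∀ i, Integrable fun v : V3 => gauss h (w i).2 v * (1 + ‖v‖) ^ 4 := fun i =>
    integrable_lM_mul_of_norm_le (by positivity) _ 0 (by fun_prop) one_add_norm_pow_four_le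
  have h2 : Integrable fun v : V3 => localMaxwellian 1 (2 * Θ) 0 v * (1 + ‖v‖) ^ 4 :=
    integrable_lM_mul_of_norm_le (by positivity) _ 0 (by fun_prop) one_add_norm_pow_four_le
  have h3 := (integrable_finsetSum Finset.univ fun i _ => h1 i).add h2
  refine h3.congr (Eventually.of_forall fun v => ?_)
  simp only [Pi.add_apply]
  rw [mul_add, Finset.mul_sum, mul_comm _ (localMaxwellian 1 (2 * Θ) 0 v)]
  congr 1
  exact Finset.sum_congr rfl fun i _ => mul_comm _ _

/-- **INTEGRABLE DOMINATOR.** For kernel bounds `0 ≤ ψ_N ≤ A`, `‖∇ψ_N‖ ≤ L`, a velocity bound `V` and a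
mass floor `S₀ > 0` there is a Lebesgue-integrable `bound` with
`|(1 + log f̂_{w'}(v)) · cW(w')⁻¹ dF_{w'}(v)| ≤ bound(v)` for EVERY configuration `w'` with the velocities of
`w` and `cW(w', x) ≥ S₀`. -/
theorem exists_dominator (hψ : ∀ y, 0 ≤ ψ N y) {A L V S₀ : ℝ} (hA : ∀ y, ψ N y ≤ A)
    (hL : ∀ y, ‖Literature.Analysis.FunctionSpaces.Torus.gradient (ψ N) y‖ ≤ L) (hV : ∀ i, ‖(w i).2‖ ≤ V)
    (hh : 0 < h) (hδ : 0 < δ) (hδ1 : δ ≤ 1) (hS₀ : 0 < S₀) :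
    ∃ bound : V3 → ℝ, Integrable bound ∧ ∀ w' : Cfg N, (∀ i, (w' i).2 = (w i).2) → S₀ ≤ cW N ψ w' x →
      ∀ v, |(1 + Real.log (cellLaw N ψ h δ w' x v)) * ((cW N ψ w' x)⁻¹ * ((1 - δ) *
          (-(∑ i, Literature.Analysis.FunctionSpaces.Torus.fderiv (ψ N) ((w' i).1 - x) (w' i).2) * kde N ψ h w' x (v) +
          ∑ i, Literature.Analysis.FunctionSpaces.Torus.fderiv (ψ N) ((w' i).1 - x) (w' i).2 * gauss h (w' i).2 (v)) + δ *
          (localMaxwellian 1 (cT N ψ w' x + h ^ 2) (cU N ψ w' x) (v) * ((-(∑ i, Literature.Analysis.FunctionSpaces.Torus.fderiv (ψ N) ((w' i).1 -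
          x) (w' i).2) * cT N ψ w' x + ∑ i, Literature.Analysis.FunctionSpaces.Torus.fderiv (ψ N) ((w' i).1 - x) (w' i).2 * (‖(w' i).2 -
          cU N ψ w' x‖ ^ 2 / 3)) * (‖(v) - cU N ψ w' x‖ ^ 2 / (2 * (cT N ψ w' x + h ^ 2) ^ 2) - 3 / (2 * (cT N ψ w' x + h ^ 2))) + inner ℝ ((v) -
          cU N ψ w' x) (-(∑ i, Literature.Analysis.FunctionSpaces.Torus.fderiv (ψ N) ((w' i).1 - x) (w' i).2) • cU N ψ w' x +
          ∑ i, Literature.Analysis.FunctionSpaces.Torus.fderiv (ψ N) ((w' i).1 - x) (w' i).2 • (w' i).2) / (cT N ψ w' x + h ^ 2)))))| ≤ bound v := by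
  have hV0 := V_nonneg w hV
  have hL0 := L_nonneg hL
  have hA0 : 0 ≤ A := (hψ 0).trans (hA 0)
  obtain ⟨Θ, hΘ⟩ : ∃ Θ : ℝ, Θ = h ^ 2 + (2 * V) ^ 2 / 3 := ⟨_, rfl⟩
  have hΘ0 : 0 < Θ := by rw [hΘ]; positivity
  obtain ⟨k₁, hk₁⟩ : ∃ k₁ : ℝ, k₁ = (1 + |Real.log ((2 * Real.pi * h ^ 2) ^ (-(3 : ℝ) / 2))| + |Real.log δ| +
      3 / 2 * (|Real.log (2 * Real.pi * h ^ 2)| + |Real.log (2 * Real.pi * (h ^ 2 + (2 * V) ^ 2 / 3))|)) +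
        (1 + V ^ 2) / h ^ 2 := ⟨_, rfl⟩
  have hk₁0 : 0 ≤ k₁ := by rw [hk₁]; positivity
  obtain ⟨k₂, hk₂⟩ : ∃ k₂ : ℝ, k₂ = (4 * V ^ 2 + V) / h ^ 2 + 2 * (4 * V ^ 2 / (3 * h ^ 4) + V / h ^ 2) * (1 + V ^ 2) :=
    ⟨_, rfl⟩
  have hk₂0 : 0 ≤ k₂ := by rw [hk₂]; positivity
  obtain ⟨Cenv, hCenv⟩ : ∃ C : ℝ, C = (2 * Real.pi * h ^ 2) ^ (-(3 : ℝ) / 2) * Real.exp (V ^ 2 / (2 * Θ)) *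
      (4 * Real.pi * Θ) ^ ((3 : ℝ) / 2) := ⟨_, rfl⟩
  have hCenv0 : 0 ≤ Cenv := by
    rw [hCenv]
    exact mul_nonneg (mul_nonneg (gMax_pos hh).le (Real.exp_pos _).le) (Real.rpow_nonneg (by positivity) _)
  obtain ⟨n, hn⟩ : ∃ n : ℝ, n = ((N + 1 : ℕ) : ℝ) := ⟨_, rfl⟩
  have hn0 : 0 ≤ n := by rw [hn]; positivity
  obtain ⟨K, hK⟩ : ∃ K : ℝ, K = S₀⁻¹ * k₁ * (n * L * V * (S₀⁻¹ * A) + n * L * V * (Cenv * k₂) + L * V) := ⟨_, rfl⟩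
  refine ⟨fun v => K * ((1 + ‖v‖) ^ 4 * (∑ i, gauss h (w i).2 v + localMaxwellian 1 (2 * Θ) 0 v)),
    (integrable_profile w hh hΘ0).const_mul K, ?_⟩
  intro w' hvel hS' v
  have hSpos : 0 < cW N ψ w' x := lt_of_lt_of_le hS₀ hS'
  have hV' : ∀ i, ‖(w' i).2‖ ≤ V := fun i => by rw [hvel i]; exact hV i
  have hG : ∑ i, gauss h (w' i).2 v = ∑ i, gauss h (w i).2 v := Finset.sum_congr rfl fun i _ => by rw [hvel i]
  set t : ℝ := (1 + ‖v‖) ^ 2 with ht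
  have ht1 : 1 ≤ t := by rw [ht]; nlinarith only [norm_nonneg v]
  set G : ℝ := ∑ i, gauss h (w i).2 v
  set M2 : ℝ := localMaxwellian 1 (2 * Θ) 0 v
  have hG0 : 0 ≤ G := Finset.sum_nonneg fun i _ => (gauss_pos hh _ _).le
  have hM20 : 0 ≤ M2 := localMaxwellian_nonneg zero_le_one (by positivity) _ _
  -- the pieces at `w'`
  have hfac := logFactor_le (δ := δ) w' x hψ hh hV' v
  rw [← hk₁] at hfac
  have hB1 := B1_le w' x hL hV'
  rw [← hn] at hB1
  have hkde : kde N ψ h w' x v ≤ S₀⁻¹ * A * G := by rw [← hG]; exact kde_le_sum_gauss w' x hψ hh hA hS₀ hS' v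
  have hlM : localMaxwellian 1 (cT N ψ w' x + h ^ 2) (cU N ψ w' x) v ≤ Cenv * M2 := by
    rw [hCenv]; exact lM_le_envelope hh (h2_le_theta w' x hψ) (hΘ ▸ theta_le (h := h) w' x hψ hV') (norm_cU_le w' x hψ hV') v
  have hP := floorPoly_le w' x hψ hh hV' v
  rw [← hk₂] at hP
  have hβG : ∑ i, |Literature.Analysis.FunctionSpaces.Torus.fderiv (ψ N) ((w' i).1 - x) (w' i).2| * gauss h (w' i).2 v ≤
      L * V * G := by rw [← hG]; exact sum_abs_dcw_gauss_le w' x hh hL hV' v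
  have hlMn := localMaxwellian_nonneg zero_le_one (theta_pos (h := h) w' x hψ hh).le (cU N ψ w' x) v
  -- the bracket
  have hbr : (∑ i, |Literature.Analysis.FunctionSpaces.Torus.fderiv (ψ N) ((w' i).1 - x) (w' i).2|) * (kde N ψ h w' x v +
      localMaxwellian 1 (cT N ψ w' x + h ^ 2) (cU N ψ w' x) v *
      (8 / 3 * V ^ 2 * (‖v - cU N ψ w' x‖ ^ 2 / (2 * h ^ 4) + 3 / (2 * h ^ 2)) + 2 * V * ‖v - cU N ψ w' x‖ / h ^ 2)) +
      ∑ i, |Literature.Analysis.FunctionSpaces.Torus.fderiv (ψ N) ((w' i).1 - x) (w' i).2| * gauss h (w' i).2 v ≤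
      (n * L * V * (S₀⁻¹ * A) + n * L * V * (Cenv * k₂) + L * V) * (t * (G + M2)) := by
    have h1 : localMaxwellian 1 (cT N ψ w' x + h ^ 2) (cU N ψ w' x) v *
        (8 / 3 * V ^ 2 * (‖v - cU N ψ w' x‖ ^ 2 / (2 * h ^ 4) + 3 / (2 * h ^ 2)) + 2 * V * ‖v - cU N ψ w' x‖ / h ^ 2) ≤
        (Cenv * M2) * (k₂ * t) := mul_le_mul hlM hP (by positivity) (by positivity)
    have h2 : kde N ψ h w' x v + localMaxwellian 1 (cT N ψ w' x + h ^ 2) (cU N ψ w' x) v *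
        (8 / 3 * V ^ 2 * (‖v - cU N ψ w' x‖ ^ 2 / (2 * h ^ 4) + 3 / (2 * h ^ 2)) + 2 * V * ‖v - cU N ψ w' x‖ / h ^ 2) ≤
        S₀⁻¹ * A * G + Cenv * M2 * (k₂ * t) := add_le_add hkde h1
    have h3 := mul_le_mul hB1 h2 (add_nonneg (kde_nonneg w' x hψ hh v) (mul_nonneg hlMn (by positivity))) (by positivity)
    have h4 : n * L * V * (S₀⁻¹ * A * G + Cenv * M2 * (k₂ * t)) + L * V * G ≤
        (n * L * V * (S₀⁻¹ * A) + n * L * V * (Cenv * k₂) + L * V) * (t * (G + M2)) := by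
      have e : (n * L * V * (S₀⁻¹ * A) + n * L * V * (Cenv * k₂) + L * V) * (t * (G + M2)) =
          n * L * V * (S₀⁻¹ * A * (G * t) + Cenv * M2 * (k₂ * t)) + L * V * (G * t) +
            (n * L * V * (S₀⁻¹ * A) * (t * M2) + n * L * V * (Cenv * k₂) * (t * G) + L * V * (t * M2)) := by ring
      rw [e]
      have hGt : G ≤ G * t := le_mul_of_one_le_right hG0 ht1
      have hx : 0 ≤ n * L * V * (S₀⁻¹ * A) * (t * M2) + n * L * V * (Cenv * k₂) * (t * G) + L * V * (t * M2) := by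
        positivity
      nlinarith only [hGt, hx, mul_le_mul_of_nonneg_left hGt (by positivity : 0 ≤ n * L * V * (S₀⁻¹ * A)),
        mul_le_mul_of_nonneg_left hGt (by positivity : 0 ≤ L * V)]
    linarith only [h3, h4, hβG]
  have hrhs0 : 0 ≤ (∑ i, |Literature.Analysis.FunctionSpaces.Torus.fderiv (ψ N) ((w' i).1 - x) (w' i).2|) * (kde N ψ h w' x v +
      localMaxwellian 1 (cT N ψ w' x + h ^ 2) (cU N ψ w' x) v *
      (8 / 3 * V ^ 2 * (‖v - cU N ψ w' x‖ ^ 2 / (2 * h ^ 4) + 3 / (2 * h ^ 2)) + 2 * V * ‖v - cU N ψ w' x‖ / h ^ 2)) +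
      ∑ i, |Literature.Analysis.FunctionSpaces.Torus.fderiv (ψ N) ((w' i).1 - x) (w' i).2| * gauss h (w' i).2 v :=
    add_nonneg (mul_nonneg (B1_nonneg w' x) (add_nonneg (kde_nonneg w' x hψ hh v) (mul_nonneg hlMn (by positivity))))
      (Finset.sum_nonneg fun i _ => mul_nonneg (abs_nonneg _) (gauss_pos hh _ _).le)
  -- the master bound, the `cW⁻¹` and the product
  have hm := abs_integrand_le (δ := δ) w' x hψ hh hδ hδ1 hV' v
  rw [show (1 + Real.log (cellLaw N ψ h δ w' x v)) * ((cW N ψ w' x)⁻¹ * ((1 - δ) *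
      (-(∑ i, Literature.Analysis.FunctionSpaces.Torus.fderiv (ψ N) ((w' i).1 - x) (w' i).2) * kde N ψ h w' x (v) +
      ∑ i, Literature.Analysis.FunctionSpaces.Torus.fderiv (ψ N) ((w' i).1 - x) (w' i).2 * gauss h (w' i).2 (v)) + δ *
      (localMaxwellian 1 (cT N ψ w' x + h ^ 2) (cU N ψ w' x) (v) * ((-(∑ i, Literature.Analysis.FunctionSpaces.Torus.fderiv (ψ N) ((w' i).1 -
      x) (w' i).2) * cT N ψ w' x + ∑ i, Literature.Analysis.FunctionSpaces.Torus.fderiv (ψ N) ((w' i).1 - x) (w' i).2 * (‖(w' i).2 -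
      cU N ψ w' x‖ ^ 2 / 3)) * (‖(v) - cU N ψ w' x‖ ^ 2 / (2 * (cT N ψ w' x + h ^ 2) ^ 2) - 3 / (2 * (cT N ψ w' x + h ^ 2))) + inner ℝ ((v) -
      cU N ψ w' x) (-(∑ i, Literature.Analysis.FunctionSpaces.Torus.fderiv (ψ N) ((w' i).1 - x) (w' i).2) • cU N ψ w' x +
      ∑ i, Literature.Analysis.FunctionSpaces.Torus.fderiv (ψ N) ((w' i).1 - x) (w' i).2 • (w' i).2) / (cT N ψ w' x + h ^ 2))))) =
    (cW N ψ w' x)⁻¹ * ((1 + Real.log (cellLaw N ψ h δ w' x v)) * ((1 - δ) * (-(∑ i, Literature.Analysis.FunctionSpaces.Torus.fderiv (ψ N) ((w' i).1 -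
        x) (w' i).2) * kde N ψ h w' x (v) + ∑ i, Literature.Analysis.FunctionSpaces.Torus.fderiv (ψ N) ((w' i).1 - x) (w' i).2 *
        gauss h (w' i).2 (v)) + δ * (localMaxwellian 1 (cT N ψ w' x + h ^ 2) (cU N ψ w' x) (v) *
        ((-(∑ i, Literature.Analysis.FunctionSpaces.Torus.fderiv (ψ N) ((w' i).1 - x) (w' i).2) * cT N ψ w' x +
        ∑ i, Literature.Analysis.FunctionSpaces.Torus.fderiv (ψ N) ((w' i).1 - x) (w' i).2 * (‖(w' i).2 - cU N ψ w' x‖ ^ 2 / 3)) * (‖(v) -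
        cU N ψ w' x‖ ^ 2 / (2 * (cT N ψ w' x + h ^ 2) ^ 2) - 3 / (2 * (cT N ψ w' x + h ^ 2))) + inner ℝ ((v) -
        cU N ψ w' x) (-(∑ i, Literature.Analysis.FunctionSpaces.Torus.fderiv (ψ N) ((w' i).1 - x) (w' i).2) • cU N ψ w' x +
        ∑ i, Literature.Analysis.FunctionSpaces.Torus.fderiv (ψ N) ((w' i).1 - x) (w' i).2 • (w' i).2) / (cT N ψ w' x + h ^ 2))))) by ring, abs_mul,
    abs_of_pos (inv_pos.2 hSpos)]
  calc (cW N ψ w' x)⁻¹ * |(1 + Real.log (cellLaw N ψ h δ w' x v)) * ((1 - δ) *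
      (-(∑ i, Literature.Analysis.FunctionSpaces.Torus.fderiv (ψ N) ((w' i).1 - x) (w' i).2) * kde N ψ h w' x (v) +
      ∑ i, Literature.Analysis.FunctionSpaces.Torus.fderiv (ψ N) ((w' i).1 - x) (w' i).2 * gauss h (w' i).2 (v)) + δ *
      (localMaxwellian 1 (cT N ψ w' x + h ^ 2) (cU N ψ w' x) (v) * ((-(∑ i, Literature.Analysis.FunctionSpaces.Torus.fderiv (ψ N) ((w' i).1 -
      x) (w' i).2) * cT N ψ w' x + ∑ i, Literature.Analysis.FunctionSpaces.Torus.fderiv (ψ N) ((w' i).1 - x) (w' i).2 * (‖(w' i).2 -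
      cU N ψ w' x‖ ^ 2 / 3)) * (‖(v) - cU N ψ w' x‖ ^ 2 / (2 * (cT N ψ w' x + h ^ 2) ^ 2) - 3 / (2 * (cT N ψ w' x + h ^ 2))) + inner ℝ ((v) -
      cU N ψ w' x) (-(∑ i, Literature.Analysis.FunctionSpaces.Torus.fderiv (ψ N) ((w' i).1 - x) (w' i).2) • cU N ψ w' x +
      ∑ i, Literature.Analysis.FunctionSpaces.Torus.fderiv (ψ N) ((w' i).1 - x) (w' i).2 • (w' i).2) / (cT N ψ w' x + h ^ 2))))|
      ≤ S₀⁻¹ * ((k₁ * t) * ((n * L * V * (S₀⁻¹ * A) + n * L * V * (Cenv * k₂) + L * V) * (t * (G + M2)))) :=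
        mul_le_mul (inv_anti₀ hS₀ hS') (hm.trans (mul_le_mul hfac hbr hrhs0 (by positivity))) (abs_nonneg _)
          (by positivity)
    _ = K * ((1 + ‖v‖) ^ 4 * (∑ i, gauss h (w i).2 v + localMaxwellian 1 (2 * Θ) 0 v)) := by
        rw [hK, ht]; ring

end EntropyBudget

/-- Registered anchor of this helper file (`--supports stmt-AtomisticToContinuum-14868`, helper of
`stub_entropyBudget`): the KDE of a cell of mass at least S₀ with weights at most A is dominated by the weight-free Gaussian profile. -/
theorem bhEntropyBudget_derivDom_anchor : ∀ (N : ℕ) (ψ : ℕ → T3 → ℝ) (h : ℝ) (w : Cfg N) (x : T3) (A S₀ : ℝ) (v : V3), (∀ y, 0 ≤ ψ N y) → 0 < h →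
    (∀ y, ψ N y ≤ A) → 0 < S₀ → S₀ ≤ cW N ψ w x → kde N ψ h w x v ≤ S₀⁻¹ * A * ∑ i, gauss h (w i).2 v :=
  fun _ _ _ w x _ _ v hψ hh hA hS₀ hS => EntropyBudget.kde_le_sum_gauss w x hψ hh hA hS₀ hS v

end

end Summit.AtomisticToContinuum.HydrodynamicLimit.Theorems.BlockHDissipation
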